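import Literature.NumberTheory.ConnesConsani2021.ArchimedeanTraceFormulaStrong
import Literature.NumberTheory.ConnesConsani2021.NumericalInputs
import Literature.NumberTheory.ConnesConsani2021.ArchKernelL1Frame
import HarnessLib

/-!
# Connes–Consani 2021, Remark 6.12 (= arXiv Remark 45): the best constant exceeds `13` —
# `CC2021_rem_6_12` REDUCED to the single analytic input (E-a) of the §6 certificate

A. Connes, C. Consani, *Weil positivity and trace formula, the archimedean place*, Selecta Math.
(N.S.) 27 (2021), Paper No. 77 = arXiv:2006.13771 [bib: `ConnesConsani2021`], §6.7, Remark 6.12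
(= Remark 45 of the arXiv text, p. 29, right after the proof of Theorem 6.11 = Thm. 44).

LABEL (line 1): RH-FREE certified bookkeeping of a printed NUMERICAL remark.  The typed fact
`CC2021_rem_6_12` (`NumericalInputs.lean`) says that the main inequality (maininequ) with the constant
`c = 13` FAILS for some admissible `g` — a LOWER bound on CC's optimal constant; it has no positivity
content and is off every closing path of the cell's route.  WHAT THIS IS NOT: any claim about RH —
nothing here bears on the truth of RH.

**What is printed** (Remark 45, arXiv p. 29, chunk p0029:L21–L40, read first-hand): "By (spectral0),
the first eigenvalue `λ₁(𝐊_I)` of `𝐊_I` fulfills `|λ₁(𝐊_I) − λ_max| ≤ ε₁` while `λ_max = 1.05158` and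
`ε₁ ≃ 0.00122`.  Thus, since `C_c^∞((−½log 2, ½log 2))` is dense in the Hilbert space
`𝓗 = L²([−½log 2, ½log 2])`, there exists a unit vector `ξ ∈ C_c^∞((−½log 2, ½log 2))` such that
`𝐊_I(ξ) ∼ λ₁(𝐊_I)ξ`.  It follows, using `N_I = −2ε′(1₊)(1 − 𝐊_I)`, that
`⟨ξ|N_I(ξ)⟩ ≥ 2ε′(1₊)(1.05 − 1)‖ξ‖² ≥ 0.1ε′(1₊)|⟨ξ₀|ξ⟩|²`.  Let then `h(ρ) := ξ(log ρ)` and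
`g(ρ) := (½ − ρ∂_ρ)h(ρ)` … One has `ĝ(−i/2) = 0` and as in the proof of Theorem 6.11 one obtains
`E(g ∗ g*) = E∘Q(h ∗ h*) = ⟨ξ|N_I(ξ)⟩ ≥ 0.1ε′(1₊)|⟨ξ₀|ξ⟩|² > 13|ĝ(0)|²`.  Thus by (sonine1thm) one gets
`W_∞(g ∗ g*) = Tr(ϑ(g)𝐒ϑ(g)*) − E(g ∗ g*) < Tr(ϑ(g)𝐒ϑ(g)*) − 13|ĝ(0)|²`.  This shows that the best
constant `c` fulfilling (maininequ) is such that `13 < c < 17`."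

**What is PROVED here** (0 named facts introduced; the printed argument, step by step, on tree
theorems):

* `CC2021_rem_6_12_of_testWitness` — "(sonine1thm) … `W_∞(g∗g*) = Tr − E < Tr − 13|ĝ(0)|²`": by the
  STRONG Theorem 4.7 (`CC2021_thm_4_7_holds`: the diagonal coefficients over a Hilbert basis of `S(1,1)`
  sum to `W_∞(f) + E(f)`), some FINITE orthonormal family of `S(1,1)` already has partial sum
  `> W_∞(f) + 13|ĝ(0)|²` as soon as `E(f) > 13|ĝ(0)|²`; with `g := k′ − k/2` ("`g = (½ − ρ∂_ρ)h`",
  `VanishingIdealReduction.opQ_weilConv_weilReflect`: `g ∗ g* = Q(k ∗ k*)`, `ĝ(−i/2) = 0` automatically,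
  `ĝ(0) = −k̂(0)/2`) the fact follows from ONE test function `k` on `I` with
  `(13/4)|k̂(0)|² < Re E₊(Q₊(k ∗ k*))`.  `W_∞` drops out.
* `CC2021_rem_6_12_of_windowWitness` — "`E∘Q(h∗h*) = ⟨ξ|N_I(ξ)⟩`, `N_I = −2ε′(1₊)(1 − 𝐊_I)`":
  `JumpFormula.evenFunctional_opQ_autocorr_eq_inner` for a `C²` archimedean density
  (`exists_contDiff_isArchDensity_summable_free`, slope `e′ = Σ t(n) ∈ [22.9, 23.1]` by the kernel
  theorem `SlopeCert.tsum_epsSlopeTerm_prolateFun_mem`) and `|⟨η₀|ξ⟩|² = L⁻¹|k̂(0)|²`: it suffices that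
  `Re⟨ξ|𝐊_Iξ⟩ − ‖ξ‖² > θ₁|⟨η₀|ξ⟩|²` for `ξ = k|_I`, with the rational `θ₁ ≥ 13·log 2/(8·22.9)`.
* `re_inner_windowOp_ge_of_analyticInput` — "(spectral0) `|λ₁(𝐊_I) − λ_max| ≤ ε₁`" in quadratic-form
  shape: the analytic input (E-a) of the cell's §6 certificate (`SpectralCert.AnalyticInputValid`, the
  first conjunct of `CC2021_section6_enclosures`: `∫|τ_c − ϖ| ≤ ε₁ = 1/400`) and Lemma 6.3 give
  `Re⟨ξ|𝐊_Iξ⟩ ≥ Σ_{|n|≤100} c_n|⟨ξ_{n/2}|ξ⟩|² − ε₁‖ξ‖²` (`SpectralCertFrame.re_inner_windowOp_frameKernel`).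
* `Rem612Cert.*` — "`𝐊_I(ξ) ∼ λ₁(𝐊_I)ξ`, `λ₁ ≈ 1.05`": the DUAL rational certificate.  For the explicit
  trigonometric vector `ξ₀ = Σ_{m ∈ {−4,−2,0,2,4}} w_m ξ_{m/2}`, `w = (−23, 225, 947, 225, −23)` (a
  5-mode approximation of the top eigenvector; float Rayleigh quotient `1.0512`, `|⟨η₀|ξ₀⟩|²/‖ξ₀‖² =
  0.898`, cf. the printed `λ_max = 1.05158`, `⟨η₀|η⟩ = 0.94865`), the quantity
  `Σ c_n|⟨ξ_{n/2}|ξ₀⟩|² − (1 + ε₁)‖ξ₀‖² − θ₁|⟨η₀|ξ₀⟩|²` is a quadratic polynomial in `t = π⁻¹` with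
  RATIONAL coefficients (Gram entries `halfSinc d = [d=0] + π⁻¹·halfSincRat d`), bounded below on
  `[t₋, t₊] ∋ π⁻¹` by a rational number decided positive by the kernel (`decide`; margin `≈ 0.0044‖ξ₀‖²`).
* `CC2021_rem_6_12_of_section6Enclosures` — "since `C_c^∞` is dense in `L²(I)`": the smooth cutoffs
  `k_δ = φ_δ · ξ₀` (Mathlib `ContDiffBump`) are test functions on `I` with `k_δ|_I → ξ₀` in `L²(I)`, and
  the finite-rank form above is continuous, so some `k_δ` is a witness.  Hence
  `CC2021_section6_enclosures → CC2021_rem_6_12`; the fact becomes a tree theorem the moment the cell's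
  Tier-2 kernel certificate of (E-a) lands (`ArchKernelL1Frame.section6_enclosures_iff_L1`).

No RH claim; no named fact introduced (net debt delta 0 now, −1 with (E-a)).
-/

noncomputable section

open MeasureTheory Set Complex Filter Topology
open scoped InnerProductSpace Real ComplexConjugate ContDiff

namespace Literature.NumberTheory.ConnesConsani2021

open Literature.NumberTheory.LFunctions SpectralCert

/-! ## Step 1: from the strong Theorem 4.7, a finite orthonormal family with large partial sum -/

/-- RH-FREE. **Partial sums of the Sonin trace get arbitrarily close to `W_∞(f) + E(f)` from below in
finitely many terms**: if `c < Re(W_∞(F) + E(F))` then some finite orthonormal family of `S(1,1)` has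
`Σ_i Re⟨ξ_i|ϑ(F)ξ_i⟩ > c` (Theorem 4.7, strong form, over a Hilbert basis of the complete space `S(1,1)`).
[cite: ConnesConsani2021, Thm. 4.7 §4 p. 18; Remark 6.12 §6.7 p. 29 ("by (sonine1thm)")] -/
theorem exists_orthonormal_sum_re_soninTraceForm_gt {F : ℝ → ℂ} (hF : IsWeilTest F) {c : ℝ}
    (hc : c < (archW F + evenFunctional (epsDensity prolateFun) F).re) :
    ∃ (n : ℕ) (ξ : Fin n → Lp ℂ 2 (volume : Measure ℝ)),
      Orthonormal ℂ ξ ∧ (∀ i, ξ i ∈ soninSpace 1 1) ∧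
        c < ∑ i, (soninTraceForm F (ξ i : ℝ → ℂ)).re := by
  obtain ⟨w, b, -⟩ := exists_hilbertBasis ℂ (soninSpace 1 1)
  have H := (CC2021_thm_4_7_holds prolateFun isProlateFunction_prolateFun F hF).1 w b
  have H1 : Tendsto (fun s : Finset w ↦ ∑ i ∈ s,
      (soninTraceForm F (((b i : soninSpace 1 1) : Lp ℂ 2 (volume : Measure ℝ)) : ℝ → ℂ)).re)
      atTop (𝓝 (archW F + evenFunctional (epsDensity prolateFun) F).re) := by
    have H2 := Complex.hasSum_re H
    simpa [HasSum] using H2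
  obtain ⟨s, hs⟩ := (H1.eventually_const_lt hc).exists
  refine ⟨s.card, fun j ↦ ((b (s.equivFin.symm j) : soninSpace 1 1) : Lp ℂ 2 (volume : Measure ℝ)),
    ?_, fun j ↦ Submodule.coe_mem _, ?_⟩
  · have hb : Orthonormal ℂ (fun i : w ↦ ((b i : soninSpace 1 1) : Lp ℂ 2 (volume : Measure ℝ))) :=
      ((soninSpace 1 1).subtypeₗᵢ.orthonormal_comp_iff).2 b.orthonormal
    exact hb.comp _ (Subtype.val_injective.comp s.equivFin.symm.injective)
  · rw [← Finset.sum_coe_sort s] at hs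
    rwa [(s.equivFin.symm).sum_comp
      (fun i : s ↦ (soninTraceForm F (((b i : soninSpace 1 1) : Lp ℂ 2 (volume : Measure ℝ)) : ℝ → ℂ)).re)]

/-! ## Step 2: `g := k′ − k/2` — the fact from ONE test-function witness on the window -/

section TestWitness

variable {k : ℝ → ℂ}

/-- `g = k′ − k/2` as in `VanishingIdealReduction.opQ_weilConv_weilReflect`. [cite: ConnesConsani2021, Remark 6.12 §6.7 p. 29 ("`g(ρ) := (½ − ρ∂_ρ)h(ρ)`")] -/
private def gOf (k : ℝ → ℂ) : ℝ → ℂ := fun t ↦ deriv k t + -(1 / 2 : ℂ) * k t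

/-- `g = k′ + (−½)k` as a sum of functions. [folklore] -/
private theorem gOf_eq (k : ℝ → ℂ) : gOf k = deriv k + fun t ↦ -(1 / 2 : ℂ) * k t := rfl

/-- `g` is a test function. [folklore] -/
private theorem isWeilTest_gOf (hk : IsWeilTest k) : IsWeilTest (gOf k) := by
  rw [gOf_eq]; exact hk.deriv.add (hk.const_mul _)

/-- `supp g ⊆ supp k`. [folklore] -/
private theorem tsupport_gOf_subset (k : ℝ → ℂ) : tsupport (gOf k) ⊆ tsupport k := by
  rw [gOf_eq]
  refine (tsupport_add _ _).trans (union_subset (tsupport_deriv_subset) ?_)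
  exact (tsupport_mul_subset_right : tsupport (fun t ↦ -(1 / 2 : ℂ) * k t) ⊆ tsupport k)

/-- `ĝ(s)` for `g = k′ − k/2` in the tree's `weilMellin`: `ĝ(s) = −s·k̂(s)`. [folklore] -/
private theorem weilMellin_gOf (hk : IsWeilTest k) (s : ℂ) :
    weilMellin (gOf k) s = -s * weilMellin k s := by
  rw [gOf_eq, weilMellin_add hk.deriv.1.continuous hk.deriv.2 (hk.const_mul _).1.continuous
      (hk.const_mul _).2, weilMellin_const_mul, weilMellin_deriv hk]
  ring

/-- "`ĝ(−i/2) = 0`" (automatic for `g = (½ − ρ∂_ρ)h`). [cite: ConnesConsani2021, Remark 6.12 §6.7 p. 29] -/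
private theorem mulFourier_gOf_neg_I_half (hk : IsWeilTest k) : mulFourier (gOf k) (-(I / 2)) = 0 := by
  rw [mulFourier_neg_I_half, weilMellin_gOf hk]; ring

/-- "`k̂(0) = −2ĝ(0)`": `ĝ(0) = −k̂(0)/2`. [cite: ConnesConsani2021, Thm. 6.11 §6.7 p. 29 (proof)] -/
private theorem mulFourier_gOf_zero (hk : IsWeilTest k) :
    mulFourier (gOf k) 0 = -(1 / 2 : ℂ) * mulFourier k 0 := by
  rw [mulFourier_zero, mulFourier_zero, weilMellin_gOf hk]

/-- RH-FREE. **Remark 6.12 from one test-function witness** ("as in the proof of Theorem 6.11 one obtains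
`E(g∗g*) = E∘Q(h∗h*) … > 13|ĝ(0)|²`.  Thus by (sonine1thm) `W_∞(g∗g*) = Tr − E < Tr − 13|ĝ(0)|²`"): if some
test function `k` supported in `I = [−½log 2, ½log 2]` has `(13/4)|k̂(0)|² < Re E₊(Q₊(k ∗ k*))` (with
`E₊` the functional of THE prolate density `ε∘exp`), then `CC2021_rem_6_12` holds, with `g = k′ − k/2`.
[cite: ConnesConsani2021, Remark 6.12 §6.7 p. 29 (arXiv Remark 45, chunk p0029:L31–L40)] -/
theorem CC2021_rem_6_12_of_testWitness (hk : IsWeilTest k)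
    (hks : tsupport k ⊆ Icc (-(Real.log 2 / 2)) (Real.log 2 / 2))
    (hE : 13 / 4 * ‖mulFourier k 0‖ ^ 2
      < (evenFunctional (epsDensity prolateFun) (opQ (weilConv k (weilReflect k)))).re) :
    CC2021_rem_6_12 := by
  have hg : IsWeilTest (gOf k) := isWeilTest_gOf hk
  have hf : weilConv (gOf k) (weilReflect (gOf k)) = opQ (weilConv k (weilReflect k)) :=
    (opQ_weilConv_weilReflect hk).symm
  have hF : IsWeilTest (weilConv (gOf k) (weilReflect (gOf k))) := hg.weilConv hg.weilReflect
  have hg0 : ‖mulFourier (gOf k) 0‖ ^ 2 = 1 / 4 * ‖mulFourier k 0‖ ^ 2 := by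
    rw [mulFourier_gOf_zero hk, norm_mul, norm_neg, mul_pow]; norm_num
  have hc : (archW (weilConv (gOf k) (weilReflect (gOf k)))).re + 13 * ‖mulFourier (gOf k) 0‖ ^ 2
      < (archW (weilConv (gOf k) (weilReflect (gOf k)))
          + evenFunctional (epsDensity prolateFun) (weilConv (gOf k) (weilReflect (gOf k)))).re := by
    rw [Complex.add_re, hg0, hf]; linarith
  obtain ⟨n, ξ, hξ, hS, hlt⟩ := exists_orthonormal_sum_re_soninTraceForm_gt hF hc
  exact ⟨gOf k, hg, (tsupport_gOf_subset k).trans hks, mulFourier_gOf_neg_I_half hk, n, ξ, hξ, hS,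
    by linarith⟩

end TestWitness

/-! ## Step 3: `E∘Q(h ∗ h*) = ⟨ξ|N_I(ξ)⟩`, `N_I = −2ε′(1₊)(1 − 𝐊_I)` — the witness in window form -/

section Window

/-- RH-FREE. The rational threshold `θ₁ = 13·0.6931471808/(8·22.9) ≥ 13·log 2/(8ε′(1₊))` (uses
`log 2 < 0.6931471808`, Mathlib `Real.log_two_lt_d9`, and `ε′(1₊) ≥ 22.9`, the kernel theorem
`SlopeCert.epsSlope_enclosure_holds`). [cite: ConnesConsani2021, Remark 6.12 §6.7 p. 29 ("`0.1ε′(1₊)|⟨ξ₀|ξ⟩|² > 13|ĝ(0)|²`")] -/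
def Rem612Cert.θ₁ : ℚ := 13 * 6931471808 / (1832 * 10 ^ 9)

/-- `θ₁` as a real decimal. [folklore] -/
private theorem Rem612Cert.θ₁_cast : ((Rem612Cert.θ₁ : ℚ) : ℝ) = 13 * 0.6931471808 / (8 * 22.9) := by
  norm_num [Rem612Cert.θ₁]

variable {k : ℝ → ℂ}

/-- RH-FREE. **Remark 6.12 from a window-form witness** ("`E(g∗g*) = E∘Q(h∗h*) = ⟨ξ|N_I(ξ)⟩`",
`N_I = −2ε′(1₊)(1 − 𝐊_I)`, Prop. 5.5): for ANY `C²` archimedean density `G` (`𝐊_I = windowOp ϖ_G`;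
`G′(0) = ε′(1₊) ∈ [22.9, 23.1]` by Lemma 5.4 + the kernel enclosure), a test function `k` on
`I = [−½log 2, ½log 2]` whose vector `ξ = k|_I` satisfies `Re⟨ξ|𝐊_Iξ⟩ − ‖ξ‖² > θ₁|⟨η₀|ξ⟩|²` is a witness
for `CC2021_rem_6_12_of_testWitness` (`|⟨η₀|ξ⟩|² = (log 2)⁻¹|k̂(0)|²`).
[cite: ConnesConsani2021, Remark 6.12 §6.7 p. 29; Prop. 5.5 §5 pp. 20–21; Lemma 5.4 p. 33] -/
theorem CC2021_rem_6_12_of_windowWitness (hk : IsWeilTest k)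
    (hks : tsupport k ⊆ Icc (-(Real.log 2 / 2)) (Real.log 2 / 2))
    {G : ℝ → ℂ} (hG : ContDiff ℝ 2 G) (hGa : IsArchDensity G)
    (hΦ : ((Rem612Cert.θ₁ : ℚ) : ℝ)
        * ‖⟪constVector (-(Real.log 2 / 2)) (Real.log 2 / 2),
            testVector hk (-(Real.log 2 / 2)) (Real.log 2 / 2)⟫_ℂ‖ ^ 2
      < RCLike.re ⟪testVector hk (-(Real.log 2 / 2)) (Real.log 2 / 2),
          windowOp (-(Real.log 2 / 2)) (Real.log 2 / 2) (integrableOn_varpi hG _ _)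
            (testVector hk (-(Real.log 2 / 2)) (Real.log 2 / 2))⟫_ℂ
        - ‖testVector hk (-(Real.log 2 / 2)) (Real.log 2 / 2)‖ ^ 2) :
    CC2021_rem_6_12 := by
  set a : ℝ := -(Real.log 2 / 2) with ha
  set b : ℝ := Real.log 2 / 2 with hb
  set ξ := testVector hk a b with hξ
  set K := windowOp a b (integrableOn_varpi hG a b) with hK
  have hab : a < b := by
    have := Real.log_pos one_lt_two
    rw [ha, hb]; linarith
  have hL : b - a = Real.log 2 := by rw [ha, hb]; ring
  -- the slope `e′ = G′(0) ∈ [22.9, 23.1]`, real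
  obtain ⟨him, hlo, -⟩ :=
    densitySlope_of_lemma_5_4 CC2021_lemma_5_4_holds SlopeCert.epsSlope_enclosure_holds G hG hGa
  set e' : ℝ := (deriv G 0).re with he'
  have hde : deriv G 0 = ((e' : ℝ) : ℂ) := Complex.ext (by simp [he']) (by simp [him])
  have hG0 : deriv G 0 ≠ 0 := by
    rw [hde]; exact_mod_cast (show e' ≠ 0 by linarith)
  -- `E = ⟨ξ, (−2e′)(ξ − Kξ)⟩`
  have hE : evenFunctional (epsDensity prolateFun) (opQ (weilConv k (weilReflect k)))
      = ⟪ξ, (-(2 * deriv G 0)) • (ξ - K ξ)⟫_ℂ := by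
    rw [← hGa.evenFunctional_eq isProlateFunction_prolateFun]
    exact evenFunctional_opQ_autocorr_eq_inner hG hG0 hk hks
  have hEre : (evenFunctional (epsDensity prolateFun) (opQ (weilConv k (weilReflect k)))).re
      = 2 * e' * (RCLike.re ⟪ξ, K ξ⟫_ℂ - ‖ξ‖ ^ 2) := by
    have hss : RCLike.re ⟪ξ, ξ⟫_ℂ = ‖ξ‖ ^ 2 := inner_self_eq_norm_sq (𝕜 := ℂ) ξ
    rw [hE, hde, show -(2 * ((e' : ℝ) : ℂ)) = (((-(2 * e')) : ℝ) : ℂ) by push_cast; ring,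
      inner_smul_right, Complex.re_ofReal_mul, inner_sub_right, Complex.sub_re]
    simp only [RCLike.re_to_complex] at hss ⊢
    rw [hss]; ring
  -- `|k̂(0)|² = log 2 · |⟨η₀, ξ⟩|²`
  have hP : ‖mulFourier k 0‖ ^ 2 = Real.log 2 * ‖⟪constVector a b, ξ⟫_ℂ‖ ^ 2 := by
    rw [hξ, norm_inner_constVector_testVector_sq hab hk hks, hL, ← mul_assoc,
      mul_inv_cancel₀ (Real.log_pos one_lt_two).ne', one_mul]
  refine CC2021_rem_6_12_of_testWitness hk hks ?_
  rw [hEre, hP]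
  have hlog : Real.log 2 < 0.6931471808 := Real.log_two_lt_d9
  have hθ : ((Rem612Cert.θ₁ : ℚ) : ℝ) = 13 * 0.6931471808 / (8 * 22.9) := Rem612Cert.θ₁_cast
  set P := ‖⟪constVector a b, ξ⟫_ℂ‖ ^ 2 with hPdef
  set D := RCLike.re ⟪ξ, K ξ⟫_ℂ - ‖ξ‖ ^ 2 with hD
  have hP0 : 0 ≤ P := by positivity
  rw [hθ] at hΦ
  have hD0 : 0 ≤ D := le_trans (by positivity) hΦ.le
  have h1 : 13 / 4 * (Real.log 2 * P) ≤ 13 / 4 * (0.6931471808 * P) := by gcongr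
  have h2 : 13 / 4 * (0.6931471808 * P) = 2 * 22.9 * (13 * 0.6931471808 / (8 * 22.9) * P) := by ring
  have h3 : 2 * 22.9 * (13 * 0.6931471808 / (8 * 22.9) * P) < 2 * 22.9 * D := by gcongr
  have h4 : 2 * 22.9 * D ≤ 2 * e' * D := by gcongr
  linarith

end Window

/-! ## Step 4: the analytic input (E-a) ⇒ `Re⟨ξ|𝐊_Iξ⟩ ≥ Σ c_n|⟨ξ_{n/2}|ξ⟩|² − ε₁‖ξ‖²` (Lemma 6.3) -/

section AnalyticInput

variable {a b : ℝ}

/-- RH-FREE. **Lemma 6.3 in quadratic-form shape** on a window `[a, b]`: if `∫_{a−b}^{b−a}|τ_c − ϖ_G| ≤ ε`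
for the trigonometric kernel `τ_c = frameKernel a b N c`, then
`Σ_{|n|≤N} c_{|n|}|⟨ξ_{n/2}|ξ⟩|² − ε‖ξ‖² ≤ Re⟨ξ|𝐊 ξ⟩` for `𝐊 = windowOp ϖ_G` (`‖𝐊 − windowOp τ_c‖ ≤ ε` and
(opkf1) `Re⟨ξ|windowOp τ_c ξ⟩ = Σ c_n|⟨ξ_{n/2}|ξ⟩|²`). [cite: ConnesConsani2021, Lemma 6.3 §6.4 p. 24; §6.4 display (opkf1) p. 24] -/
theorem re_inner_windowOp_ge_of_L1 (hab : a < b) {G : ℝ → ℂ} (hG : ContDiff ℝ 2 G) (N : ℕ) (c : ℕ → ℝ)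
    {ε : ℝ} (hL1 : ∫ v in Icc (a - b) (b - a), ‖frameKernel a b N c v - varpi G v‖ ≤ ε)
    (ξ : Lp ℂ 2 (volume.restrict (Icc a b))) :
    ∑ n ∈ Finset.Icc (-(N : ℤ)) N, c n.natAbs * ‖⟪expVector a b ((n : ℝ) / 2), ξ⟫_ℂ‖ ^ 2 - ε * ‖ξ‖ ^ 2
      ≤ RCLike.re ⟪ξ, windowOp a b (integrableOn_varpi hG a b) ξ⟫_ℂ := by
  have hKT : ‖windowOp a b (integrableOn_varpi hG a b) - windowOp a b (integrableOn_frameKernel a b N c)‖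
      ≤ ε :=
    (norm_windowOp_sub_windowOp_le (integrableOn_varpi hG a b) (integrableOn_frameKernel a b N c)).trans hL1
  have hb : -(ε * ‖ξ‖ ^ 2)
      ≤ RCLike.re ⟪ξ, (windowOp a b (integrableOn_varpi hG a b)
          - windowOp a b (integrableOn_frameKernel a b N c)) ξ⟫_ℂ := by
    have hb' : ‖⟪ξ, (windowOp a b (integrableOn_varpi hG a b)
        - windowOp a b (integrableOn_frameKernel a b N c)) ξ⟫_ℂ‖ ≤ ε * ‖ξ‖ ^ 2 :=
      calc _ ≤ ‖ξ‖ * ‖(windowOp a b (integrableOn_varpi hG a b)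
              - windowOp a b (integrableOn_frameKernel a b N c)) ξ‖ := norm_inner_le_norm _ _
        _ ≤ ‖ξ‖ * (‖windowOp a b (integrableOn_varpi hG a b)
              - windowOp a b (integrableOn_frameKernel a b N c)‖ * ‖ξ‖) := by
            gcongr; exact ContinuousLinearMap.le_opNorm _ ξ
        _ ≤ ‖ξ‖ * (ε * ‖ξ‖) := by gcongr
        _ = ε * ‖ξ‖ ^ 2 := by ring
    have h := RCLike.abs_re_le_norm ⟪ξ, (windowOp a b (integrableOn_varpi hG a b)
        - windowOp a b (integrableOn_frameKernel a b N c)) ξ⟫_ℂ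
    rw [abs_le] at h
    linarith [h.1]
  have hsplit : ⟪ξ, windowOp a b (integrableOn_varpi hG a b) ξ⟫_ℂ
      = ⟪ξ, windowOp a b (integrableOn_frameKernel a b N c) ξ⟫_ℂ
        + ⟪ξ, (windowOp a b (integrableOn_varpi hG a b)
            - windowOp a b (integrableOn_frameKernel a b N c)) ξ⟫_ℂ := by
    rw [show (windowOp a b (integrableOn_varpi hG a b)
        - windowOp a b (integrableOn_frameKernel a b N c)) ξ
        = windowOp a b (integrableOn_varpi hG a b) ξ - windowOp a b (integrableOn_frameKernel a b N c) ξ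
        from rfl, inner_sub_right]; ring
  rw [hsplit, map_add, re_inner_windowOp_frameKernel hab N c ξ]
  linarith

/-- RH-FREE. **(spectral0) in quadratic-form shape, from (E-a)**: with `τ_c` the certificate kernel of
`SpectralCert.CertAF` (`N = 100` half-integer modes) and `∫_{[−log 2, log 2]}|τ_c − ϖ_G| ≤ ε₁ = 1/400`
(`SpectralCert.AnalyticInputValid G`), `Σ_{|n|≤N} c_{|n|}|⟨ξ_{n/2}|ξ⟩|² − ε₁‖ξ‖² ≤ Re⟨ξ|𝐊_Iξ⟩`.
[cite: ConnesConsani2021, Lemma 6.3 §6.4 p. 24; §6.7 eq. (spectral0) p. 28] -/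
theorem re_inner_windowOp_ge_of_analyticInput {G : ℝ → ℂ} (hG : ContDiff ℝ 2 G)
    (hEa : AnalyticInputValid G)
    (ξ : Lp ℂ 2 (volume.restrict (Icc (-(Real.log 2 / 2)) (Real.log 2 / 2)))) :
    ∑ n ∈ Finset.Icc (-(CertAF.N : ℤ)) CertAF.N,
        (CertAF.c n.natAbs : ℝ) * ‖⟪expVector (-(Real.log 2 / 2)) (Real.log 2 / 2) ((n : ℝ) / 2), ξ⟫_ℂ‖ ^ 2
      - ((CertAF.ε₁ : ℚ) : ℝ) * ‖ξ‖ ^ 2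
      ≤ RCLike.re ⟪ξ, windowOp (-(Real.log 2 / 2)) (Real.log 2 / 2) (integrableOn_varpi hG _ _) ξ⟫_ℂ := by
  have hab : -(Real.log 2 / 2) < Real.log 2 / 2 := by
    have := Real.log_pos one_lt_two; linarith
  refine re_inner_windowOp_ge_of_L1 hab hG CertAF.N (fun n ↦ (CertAF.c n : ℝ)) ?_ ξ
  have hw : Icc (-(Real.log 2 / 2) - Real.log 2 / 2) (Real.log 2 / 2 - -(Real.log 2 / 2))
      = Icc (-Real.log 2) (Real.log 2) := by
    congr 1 <;> ring
  rw [hw]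
  exact hEa

end AnalyticInput

/-! ## Step 5: the dual rational certificate ("`𝐊_I(ξ) ∼ λ₁(𝐊_I)ξ`, `λ₁ ≈ 1.05`") -/

namespace Rem612Cert

/-- RH-FREE. The five half-integer indices `m ∈ {−4, −2, 0, 2, 4}` (frequencies `m/2 = 0, ±1, ±2`) of the
witness. [cite: ConnesConsani2021, Remark 6.12 §6.7 p. 29; §6.4 display (xialpha) p. 24] -/
def S : Finset ℤ := {-4, -2, 0, 2, 4}

/-- RH-FREE. The witness coefficients `w = (−23, 225, 947, 225, −23)` on `S` (a 5-mode even approximation of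
the top eigenvector of `𝐊_I`; cf. the printed `⟨η₀|η⟩ = 0.94865`). [cite: ConnesConsani2021, Remark 6.12 §6.7 p. 29; Fact 6.5 p. 25] -/
def w (m : ℤ) : ℚ :=
  if m = -4 then -23 else if m = -2 then 225 else if m = 0 then 947 else if m = 2 then 225
  else if m = 4 then -23 else 0

/-- `A_n = Σ_{m∈S} w_m [m = n]`: the `π`-free part of `⟨ξ_{n/2}|ξ₀⟩`. [folklore] -/
def A (n : ℤ) : ℚ := ∑ m ∈ S, w m * (if m - n = 0 then 1 else 0)

/-- `B_n = Σ_{m∈S} w_m · halfSincRat(m − n)`: the coefficient of `π⁻¹` in `⟨ξ_{n/2}|ξ₀⟩`. [folklore] -/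
def B (n : ℤ) : ℚ := ∑ m ∈ S, w m * halfSincRat (m - n)

/-- `π`-free part of `‖ξ₀‖²`. [folklore] -/
def nA : ℚ := ∑ m ∈ S, w m * A m

/-- `π⁻¹`-coefficient of `‖ξ₀‖²` (it is `0`: even differences). [folklore] -/
def nB : ℚ := ∑ m ∈ S, w m * B m

/-- Constant coefficient of the certificate polynomial `P(t) = Σ c_n(A_n + tB_n)² − (1+ε₁)(nA + t·nB) −
θ₁(A_0 + tB_0)²`. [folklore] -/
def p0 : ℚ :=
  (∑ n ∈ Finset.Icc (-(CertAF.N : ℤ)) CertAF.N, CertAF.c n.natAbs * A n ^ 2)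
    - (1 + CertAF.ε₁) * nA - θ₁ * A 0 ^ 2

/-- Linear coefficient of `P`. [folklore] -/
def p1 : ℚ :=
  (∑ n ∈ Finset.Icc (-(CertAF.N : ℤ)) CertAF.N, CertAF.c n.natAbs * (2 * A n * B n))
    - (1 + CertAF.ε₁) * nB - θ₁ * (2 * A 0 * B 0)

/-- Quadratic coefficient of `P`. [folklore] -/
def p2 : ℚ :=
  (∑ n ∈ Finset.Icc (-(CertAF.N : ℤ)) CertAF.N, CertAF.c n.natAbs * B n ^ 2) - θ₁ * B 0 ^ 2

/-- A rational lower bound of `P` on `[t₋, t₊]` (`t₋ ≥ 0`). [folklore] -/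
def Plo : ℚ :=
  p0 + min (p1 * CertAF.tlo) (p1 * CertAF.thi) + min (p2 * CertAF.tlo ^ 2) (p2 * CertAF.thi ^ 2)

/-- RH-FREE. **The certificate is positive** (decided by the kernel in exact rational arithmetic over all
`201` modes of the CertAF table; value `≈ 4384.5 ≈ 0.0044·‖w‖²`). [cite: ConnesConsani2021, Remark 6.12 §6.7 p. 29 ("`λ_max = 1.05158`, `ε₁ ≃ 0.00122`"); certificate data cc/engine cert-AF.json sha16 c9b33fffc99c81ac] -/
theorem Plo_pos : 0 < Plo := by
  decide +kernel

/-- `0 ≤ t₋`. [folklore] -/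
private theorem tlo_nonneg : 0 ≤ CertAF.tlo := by
  decide +kernel

/-- A quadratic `p₀ + p₁t + p₂t²` on `[t₋, t₊] ⊆ [0, ∞)` is bounded below by
`p₀ + min(p₁t₋, p₁t₊) + min(p₂t₋², p₂t₊²)`. [folklore] -/
private theorem poly_lower_bound {q0 q1 q2 lo hi t : ℝ} (h0 : 0 ≤ lo) (hlo : lo ≤ t) (hhi : t ≤ hi) :
    q0 + min (q1 * lo) (q1 * hi) + min (q2 * lo ^ 2) (q2 * hi ^ 2) ≤ q0 + q1 * t + q2 * t ^ 2 := by
  have ht : 0 ≤ t := h0.trans hlo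
  have h1 : min (q1 * lo) (q1 * hi) ≤ q1 * t := by
    rcases le_total 0 q1 with hq | hq
    · exact (min_le_left _ _).trans (by nlinarith)
    · exact (min_le_right _ _).trans (by nlinarith)
  have h2 : min (q2 * lo ^ 2) (q2 * hi ^ 2) ≤ q2 * t ^ 2 := by
    have hl2 : lo ^ 2 ≤ t ^ 2 := by gcongr
    have hh2 : t ^ 2 ≤ hi ^ 2 := by gcongr
    rcases le_total 0 q2 with hq | hq
    · exact (min_le_left _ _).trans (by nlinarith)
    · exact (min_le_right _ _).trans (by nlinarith)
  linarith

/-- The certificate polynomial at `t = π⁻¹` is positive. [folklore] -/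
private theorem poly_pos_at_inv_pi :
    0 < (p0 : ℝ) + (p1 : ℝ) * π⁻¹ + (p2 : ℝ) * π⁻¹ ^ 2 := by
  have hP : (0 : ℝ) < (Plo : ℝ) := by exact_mod_cast Plo_pos
  have hlo : (0 : ℝ) ≤ (CertAF.tlo : ℝ) := by exact_mod_cast tlo_nonneg
  have h := poly_lower_bound (q0 := (p0 : ℝ)) (q1 := (p1 : ℝ)) (q2 := (p2 : ℝ)) hlo CertAF.tlo_le
    CertAF.le_thi
  have e : ((Plo : ℚ) : ℝ) = (p0 : ℝ) + min ((p1 : ℝ) * (CertAF.tlo : ℝ)) ((p1 : ℝ) * (CertAF.thi : ℝ))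
      + min ((p2 : ℝ) * (CertAF.tlo : ℝ) ^ 2) ((p2 : ℝ) * (CertAF.thi : ℝ) ^ 2) := by
    push_cast [Plo]; ring
  linarith

/-! ### The witness vector `ξ₀` and its frame coordinates -/

/-- RH-FREE. **The witness vector** `ξ₀ = Σ_{m∈S} w_m ξ_{m/2} ∈ L²(I)`, `I = [−½log 2, ½log 2]`.
[cite: ConnesConsani2021, Remark 6.12 §6.7 p. 29 ("a unit vector `ξ` … `𝐊_I(ξ) ∼ λ₁(𝐊_I)ξ`"); §6.4 display (xialpha) p. 24] -/
def xi0 : Lp ℂ 2 (volume.restrict (Icc (-(Real.log 2 / 2)) (Real.log 2 / 2))) :=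
  ∑ m ∈ S, ((w m : ℚ) : ℂ) • expVector (-(Real.log 2 / 2)) (Real.log 2 / 2) ((m : ℝ) / 2)

/-- Casting the indicator `[d = 0]` from `ℚ` to `ℝ`. [folklore] -/
private theorem cast_ite_eq_zero (d : ℤ) :
    (((if d = 0 then 1 else 0 : ℚ)) : ℝ) = if d = 0 then 1 else 0 := by
  split_ifs <;> simp

/-- `Σ_m w_m · halfSinc(m − n) = A_n + π⁻¹B_n`. [folklore] -/
private theorem sum_w_halfSinc (n : ℤ) :
    ∑ m ∈ S, ((w m : ℚ) : ℝ) * halfSinc (m - n) = ((A n : ℚ) : ℝ) + π⁻¹ * ((B n : ℚ) : ℝ) := by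
  simp only [A, B, Rat.cast_sum, Rat.cast_mul, cast_ite_eq_zero, Finset.mul_sum, ← Finset.sum_add_distrib]
  refine Finset.sum_congr rfl fun m _ ↦ ?_
  rw [halfSinc_eq]
  ring

/-- RH-FREE. **Frame coordinates of the witness**: `⟨ξ_{n/2}|ξ₀⟩ = A_n + π⁻¹B_n` (Gram matrix
`⟨ξ_{n/2}|ξ_{m/2}⟩ = sinc(π(m−n)/2)`, Lemma 6.6). [cite: ConnesConsani2021, Lemma 6.6 §6.6 pp. 25–26 (proof)] -/
theorem inner_expVector_xi0 (n : ℤ) :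
    ⟪expVector (-(Real.log 2 / 2)) (Real.log 2 / 2) ((n : ℝ) / 2), xi0⟫_ℂ
      = (((((A n : ℚ) : ℝ) + π⁻¹ * ((B n : ℚ) : ℝ)) : ℝ) : ℂ) := by
  rw [← sum_w_halfSinc, xi0, inner_sum]
  push_cast
  refine Finset.sum_congr rfl fun m _ ↦ ?_
  rw [inner_smul_right, inner_expVector_halfInt (Real.log_pos one_lt_two)]

/-- `⟨η₀|ξ₀⟩ = A_0 + π⁻¹B_0` (`η₀ = ξ_0`). [cite: ConnesConsani2021, §6.7 p. 28 ("the constant function normalized")] -/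
theorem inner_constVector_xi0 :
    ⟪constVector (-(Real.log 2 / 2)) (Real.log 2 / 2), xi0⟫_ℂ
      = (((((A 0 : ℚ) : ℝ) + π⁻¹ * ((B 0 : ℚ) : ℝ)) : ℝ) : ℂ) := by
  rw [← expVector_zero_eq_constVector, show (0 : ℝ) = (((0 : ℤ) : ℝ) / 2) by simp, inner_expVector_xi0]

/-- `‖ξ₀‖² = nA + π⁻¹·nB`. [folklore] -/
private theorem norm_xi0_sq : ‖xi0‖ ^ 2 = ((nA : ℚ) : ℝ) + π⁻¹ * ((nB : ℚ) : ℝ) := by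
  have h1 : ⟪xi0, xi0⟫_ℂ = ∑ m ∈ S, ((w m : ℚ) : ℂ)
      * (((((A m : ℚ) : ℝ) + π⁻¹ * ((B m : ℚ) : ℝ)) : ℝ) : ℂ) := by
    calc ⟪xi0, xi0⟫_ℂ = ⟪∑ m ∈ S, ((w m : ℚ) : ℂ)
          • expVector (-(Real.log 2 / 2)) (Real.log 2 / 2) ((m : ℝ) / 2), xi0⟫_ℂ := rfl
      _ = _ := by
        rw [sum_inner]
        refine Finset.sum_congr rfl fun m _ ↦ ?_
        rw [inner_smul_left, inner_expVector_xi0]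
        congr 1
        rw [← Complex.ofReal_ratCast, Complex.conj_ofReal]
  rw [← inner_self_eq_norm_sq (𝕜 := ℂ), h1]
  simp only [nA, nB, Rat.cast_sum, Rat.cast_mul, Finset.mul_sum, ← Finset.sum_add_distrib, map_sum]
  refine Finset.sum_congr rfl fun m _ ↦ ?_
  rw [← Complex.ofReal_ratCast, ← Complex.ofReal_mul, RCLike.re_to_complex, Complex.ofReal_re]
  ring

/-- RH-FREE. **The certificate inequality for `ξ₀`**:
`Σ_{|n|≤N} c_n|⟨ξ_{n/2}|ξ₀⟩|² − (1 + ε₁)‖ξ₀‖² − θ₁|⟨η₀|ξ₀⟩|² = P(π⁻¹) > 0`.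
[cite: ConnesConsani2021, Remark 6.12 §6.7 p. 29; certificate data cc/engine cert-AF.json sha16 c9b33fffc99c81ac] -/
theorem cert_xi0 :
    0 < ∑ n ∈ Finset.Icc (-(CertAF.N : ℤ)) CertAF.N,
        (CertAF.c n.natAbs : ℝ) * ‖⟪expVector (-(Real.log 2 / 2)) (Real.log 2 / 2) ((n : ℝ) / 2), xi0⟫_ℂ‖ ^ 2
      - (1 + ((CertAF.ε₁ : ℚ) : ℝ)) * ‖xi0‖ ^ 2
      - ((θ₁ : ℚ) : ℝ) * ‖⟪constVector (-(Real.log 2 / 2)) (Real.log 2 / 2), xi0⟫_ℂ‖ ^ 2 := by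
  have hn : ∀ x : ℝ, ‖((x : ℝ) : ℂ)‖ ^ 2 = x ^ 2 := fun x ↦ by
    rw [Complex.norm_real, Real.norm_eq_abs, sq_abs]
  simp only [inner_expVector_xi0, inner_constVector_xi0, hn, norm_xi0_sq]
  set t : ℝ := π⁻¹ with ht
  have hsum : ∑ n ∈ Finset.Icc (-(CertAF.N : ℤ)) CertAF.N,
      (CertAF.c n.natAbs : ℝ) * (((A n : ℚ) : ℝ) + t * ((B n : ℚ) : ℝ)) ^ 2
      = (∑ n ∈ Finset.Icc (-(CertAF.N : ℤ)) CertAF.N, (CertAF.c n.natAbs : ℝ) * ((A n : ℚ) : ℝ) ^ 2)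
        + t * (∑ n ∈ Finset.Icc (-(CertAF.N : ℤ)) CertAF.N,
            (CertAF.c n.natAbs : ℝ) * (2 * ((A n : ℚ) : ℝ) * ((B n : ℚ) : ℝ)))
        + t ^ 2 * (∑ n ∈ Finset.Icc (-(CertAF.N : ℤ)) CertAF.N,
            (CertAF.c n.natAbs : ℝ) * ((B n : ℚ) : ℝ) ^ 2) := by
    rw [Finset.mul_sum, Finset.mul_sum, ← Finset.sum_add_distrib, ← Finset.sum_add_distrib]
    exact Finset.sum_congr rfl fun n _ ↦ by ring
  have key : (∑ n ∈ Finset.Icc (-(CertAF.N : ℤ)) CertAF.N,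
        (CertAF.c n.natAbs : ℝ) * (((A n : ℚ) : ℝ) + t * ((B n : ℚ) : ℝ)) ^ 2)
      - (1 + ((CertAF.ε₁ : ℚ) : ℝ)) * (((nA : ℚ) : ℝ) + t * ((nB : ℚ) : ℝ))
      - ((θ₁ : ℚ) : ℝ) * (((A 0 : ℚ) : ℝ) + t * ((B 0 : ℚ) : ℝ)) ^ 2
      = (p0 : ℝ) + (p1 : ℝ) * t + (p2 : ℝ) * t ^ 2 := by
    rw [hsum]
    push_cast [p0, p1, p2]
    ring
  rw [key, ht]
  exact poly_pos_at_inv_pi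

/-! ### "since `C_c^∞` is dense in `L²(I)`": smooth cutoffs of `ξ₀` -/

/-- RH-FREE. The witness as a function: `ξ₀(x) = Σ_{m∈S} w_m ξ_{m/2}(x)` (a trigonometric polynomial).
[cite: ConnesConsani2021, §6.4 display (xialpha) p. 24] -/
def xi0Fun (x : ℝ) : ℂ :=
  ∑ m ∈ S, ((w m : ℚ) : ℂ) * expFun (-(Real.log 2 / 2)) (Real.log 2 / 2) ((m : ℝ) / 2) x

/-- CC's `ξ_α(x) = L^{−1/2}e^{2πiαx/L}` is smooth. [cite: ConnesConsani2021, §6.4 display (xialpha) p. 24] -/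
theorem contDiff_expFun (a b α : ℝ) : ContDiff ℝ ∞ (expFun a b α) := by
  unfold expFun
  refine contDiff_const.mul (Complex.contDiff_exp.comp ?_)
  refine ContDiff.mul ?_ contDiff_const
  exact Complex.ofRealCLM.contDiff.comp ((contDiff_const.mul contDiff_id).div_const _)

/-- `ξ₀` is smooth. [folklore] -/
private theorem contDiff_xi0Fun : ContDiff ℝ ∞ xi0Fun := by
  unfold xi0Fun
  exact ContDiff.sum fun m _ ↦ contDiff_const.mul (contDiff_expFun _ _ _)

/-- A uniform bound `‖ξ₀(x)‖ ≤ M`. [folklore] -/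
private theorem norm_xi0Fun_le (x : ℝ) :
    ‖xi0Fun x‖ ≤ ∑ m ∈ S, ‖((w m : ℚ) : ℂ)‖ * (Real.sqrt (Real.log 2 / 2 - -(Real.log 2 / 2)))⁻¹ := by
  unfold xi0Fun
  refine (norm_sum_le _ _).trans (Finset.sum_le_sum fun m _ ↦ ?_)
  rw [norm_mul, norm_expFun]

/-- RH-FREE. **The smooth cutoffs** `k_φ = φ · ξ₀` of the witness (`φ` a Mathlib `ContDiffBump` at `0`).
[cite: ConnesConsani2021, Remark 6.12 §6.7 p. 29 ("since `C_c^∞((−½log 2, ½log 2))` is dense in the Hilbert space `𝓗`")] -/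
def cutoffFun (φ : ContDiffBump (0 : ℝ)) (x : ℝ) : ℂ := ((φ x : ℝ) : ℂ) * xi0Fun x

/-- `k_φ ∈ C_c^∞(ℝ)` ("there exists a unit vector `ξ ∈ C_c^∞((−½log 2, ½log 2))` …").
[cite: ConnesConsani2021, Remark 6.12 §6.7 p. 29] -/
theorem isWeilTest_cutoffFun (φ : ContDiffBump (0 : ℝ)) : IsWeilTest (cutoffFun φ) := by
  refine ⟨(Complex.ofRealCLM.contDiff.comp φ.contDiff).mul contDiff_xi0Fun, ?_⟩
  have h1 : HasCompactSupport (fun x : ℝ ↦ ((φ x : ℝ) : ℂ)) :=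
    φ.hasCompactSupport.comp_left Complex.ofReal_zero
  exact h1.mul_right

/-- `supp k_φ ⊆ [−r_out, r_out] ⊆ I = [−½log 2, ½log 2]` when `r_out < ½log 2` ("`ξ ∈ C_c^∞((−½log 2, ½log 2))`").
[cite: ConnesConsani2021, Remark 6.12 §6.7 p. 29] -/
theorem tsupport_cutoffFun_subset (φ : ContDiffBump (0 : ℝ)) (hφ : φ.rOut < Real.log 2 / 2) :
    tsupport (cutoffFun φ) ⊆ Icc (-(Real.log 2 / 2)) (Real.log 2 / 2) := by
  refine (tsupport_mul_subset_left :
    tsupport (cutoffFun φ) ⊆ tsupport (fun x : ℝ ↦ ((φ x : ℝ) : ℂ))).trans ?_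
  have h1 : tsupport (fun x : ℝ ↦ ((φ x : ℝ) : ℂ)) ⊆ tsupport φ :=
    closure_mono (Function.support_comp_subset Complex.ofReal_zero φ)
  refine h1.trans ?_
  rw [φ.tsupport_eq, Real.closedBall_eq_Icc, zero_sub, zero_add]
  exact Icc_subset_Icc (by linarith) hφ.le

/-- The `L²(I)` class of `ξ₀` is the function `ξ₀` a.e. [folklore] -/
private theorem xi0_ae_eq :
    ((xi0 : Lp ℂ 2 (volume.restrict (Icc (-(Real.log 2 / 2)) (Real.log 2 / 2)))) : ℝ → ℂ)
      =ᵐ[volume.restrict (Icc (-(Real.log 2 / 2)) (Real.log 2 / 2))] xi0Fun := by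
  have h2 : ∀ᵐ x ∂(volume.restrict (Icc (-(Real.log 2 / 2)) (Real.log 2 / 2))), ∀ m ∈ S,
      ((((w m : ℚ) : ℂ) • expVector (-(Real.log 2 / 2)) (Real.log 2 / 2) ((m : ℝ) / 2) :
          Lp ℂ 2 (volume.restrict (Icc (-(Real.log 2 / 2)) (Real.log 2 / 2)))) : ℝ → ℂ) x
        = ((w m : ℚ) : ℂ) * expFun (-(Real.log 2 / 2)) (Real.log 2 / 2) ((m : ℝ) / 2) x := by
    refine (eventually_all_finset S).2 fun m _ ↦ ?_
    filter_upwards [Lp.coeFn_smul ((w m : ℚ) : ℂ)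
        (expVector (-(Real.log 2 / 2)) (Real.log 2 / 2) ((m : ℝ) / 2)),
      coeFn_expVector (-(Real.log 2 / 2)) (Real.log 2 / 2) ((m : ℝ) / 2)] with x h1 h3
    rw [h1, Pi.smul_apply, h3, smul_eq_mul]
  unfold xi0 xi0Fun
  filter_upwards [Lp.coeFn_fun_finsetSum S (fun m ↦ ((w m : ℚ) : ℂ)
      • expVector (-(Real.log 2 / 2)) (Real.log 2 / 2) ((m : ℝ) / 2)), h2] with x hx h
  rw [hx]
  exact Finset.sum_congr rfl h

/-- `‖v‖² = ∫_I ‖v‖²` on `L²(I)`. [folklore] -/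
private theorem norm_sq_eq_integral {μ : Measure ℝ} (v : Lp ℂ 2 μ) :
    ‖v‖ ^ 2 = ∫ x, ‖(v : ℝ → ℂ) x‖ ^ 2 ∂μ := by
  rw [← inner_self_eq_norm_sq (𝕜 := ℂ), L2.inner_def]
  have h1 : ∫ x, ⟪(v : ℝ → ℂ) x, (v : ℝ → ℂ) x⟫_ℂ ∂μ = ∫ x, (((‖(v : ℝ → ℂ) x‖ ^ 2 : ℝ)) : ℂ) ∂μ := by
    refine integral_congr_ae (Eventually.of_forall fun x ↦ ?_)
    simp only [inner_self_eq_norm_sq_to_K]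
    norm_cast
  rw [h1, integral_complex_ofReal, RCLike.re_to_complex, Complex.ofReal_re]

/-- RH-FREE. **`L²` distance of the cutoff to the witness**: for `r_out < ½log 2`,
`‖k_φ|_I − ξ₀‖² ≤ M²·(log 2 − 2r_in)` (`φ = 1` on `[−r_in, r_in]`, `0 ≤ φ ≤ 1`, `‖ξ₀‖_∞ ≤ M`).
[cite: ConnesConsani2021, Remark 6.12 §6.7 p. 29 ("since `C_c^∞` … is dense in the Hilbert space `𝓗`")] -/
theorem norm_testVector_cutoff_sub_xi0_sq_le (φ : ContDiffBump (0 : ℝ)) (hφ : φ.rOut < Real.log 2 / 2) :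
    ‖testVector (isWeilTest_cutoffFun φ) (-(Real.log 2 / 2)) (Real.log 2 / 2) - xi0‖ ^ 2
      ≤ (∑ m ∈ S, ‖((w m : ℚ) : ℂ)‖ * (Real.sqrt (Real.log 2 / 2 - -(Real.log 2 / 2)))⁻¹) ^ 2
          * (Real.log 2 - 2 * φ.rIn) := by
  set a : ℝ := -(Real.log 2 / 2) with ha
  set b : ℝ := Real.log 2 / 2 with hb
  set M : ℝ := ∑ m ∈ S, ‖((w m : ℚ) : ℂ)‖ * (Real.sqrt (b - a))⁻¹ with hM
  set μ : Measure ℝ := volume.restrict (Icc a b) with hμ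
  have hr : φ.rIn < Real.log 2 / 2 := φ.rIn_lt_rOut.trans hφ
  have hM0 : 0 ≤ M := Finset.sum_nonneg fun m _ ↦ by positivity
  -- the difference as a function
  have hdiff : ((testVector (isWeilTest_cutoffFun φ) a b - xi0 : Lp ℂ 2 μ) : ℝ → ℂ)
      =ᵐ[μ] fun x ↦ cutoffFun φ x - xi0Fun x := by
    filter_upwards [Lp.coeFn_sub (testVector (isWeilTest_cutoffFun φ) a b) xi0,
      coeFn_testVector (isWeilTest_cutoffFun φ) a b, xi0_ae_eq] with x h1 h2 h3
    rw [h1, Pi.sub_apply, h2, h3]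
  -- pointwise bound by an indicator
  set g : ℝ → ℝ := (Icc (-φ.rIn) φ.rIn)ᶜ.indicator fun _ ↦ M ^ 2 with hg
  have hpt : ∀ x, ‖cutoffFun φ x - xi0Fun x‖ ^ 2 ≤ g x := by
    intro x
    have hx1 : ‖cutoffFun φ x - xi0Fun x‖ = |φ x - 1| * ‖xi0Fun x‖ := by
      rw [cutoffFun, ← sub_one_mul (((φ x : ℝ) : ℂ)) (xi0Fun x), norm_mul]
      congr 1
      rw [show ((φ x : ℝ) : ℂ) - 1 = (((φ x - 1 : ℝ)) : ℂ) by push_cast; ring, Complex.norm_real,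
        Real.norm_eq_abs]
    by_cases hx : x ∈ Icc (-φ.rIn) φ.rIn
    · have h1 : φ x = 1 := φ.one_of_mem_closedBall (by
        rw [Real.closedBall_eq_Icc, zero_sub, zero_add]; exact hx)
      rw [hg, Set.indicator_of_notMem (by simpa using hx), hx1, h1, sub_self, abs_zero, zero_mul]
      simp
    · rw [hg, Set.indicator_of_mem (by simpa using hx), hx1, mul_pow]
      have h2 : |φ x - 1| ≤ 1 := by
        rw [abs_sub_comm, abs_of_nonneg (by linarith [φ.le_one (x := x)])]
        linarith [φ.nonneg (x := x)]
      have h3 : ‖xi0Fun x‖ ≤ M := norm_xi0Fun_le x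
      have h4 : |φ x - 1| ^ 2 ≤ 1 := by nlinarith [abs_nonneg (φ x - 1)]
      have h5 : ‖xi0Fun x‖ ^ 2 ≤ M ^ 2 := by gcongr
      nlinarith [norm_nonneg (xi0Fun x)]
  -- integrate
  have hgi : Integrable g μ := by
    rw [hg]
    exact (integrable_const (M ^ 2)).indicator measurableSet_Icc.compl
  have hint : ∫ x, ‖((testVector (isWeilTest_cutoffFun φ) a b - xi0 : Lp ℂ 2 μ) : ℝ → ℂ) x‖ ^ 2 ∂μ
      ≤ ∫ x, g x ∂μ := by
    refine integral_mono_of_nonneg (Eventually.of_forall fun x ↦ by positivity) hgi ?_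
    filter_upwards [hdiff] with x hx
    rw [hx]
    exact hpt x
  have hg_int : ∫ x, g x ∂μ = μ.real (Icc (-φ.rIn) φ.rIn)ᶜ * M ^ 2 := by
    rw [hg, integral_indicator_const _ measurableSet_Icc.compl, smul_eq_mul]
  -- measure of the two end strips
  have hmeas : μ.real (Icc (-φ.rIn) φ.rIn)ᶜ ≤ Real.log 2 - 2 * φ.rIn := by
    rw [hμ, measureReal_restrict_apply measurableSet_Icc.compl]
    have hsub : (Icc (-φ.rIn) φ.rIn)ᶜ ∩ Icc a b ⊆ Icc a (-φ.rIn) ∪ Icc φ.rIn b := by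
      intro x hx
      simp only [mem_inter_iff, mem_compl_iff, mem_Icc, not_and_or, not_le] at hx
      rcases hx.1 with h | h
      · exact Or.inl ⟨hx.2.1, h.le⟩
      · exact Or.inr ⟨h.le, hx.2.2⟩
    calc (volume : Measure ℝ).real ((Icc (-φ.rIn) φ.rIn)ᶜ ∩ Icc a b)
        ≤ (volume : Measure ℝ).real (Icc a (-φ.rIn) ∪ Icc φ.rIn b) :=
          measureReal_mono hsub (measure_union_lt_top measure_Icc_lt_top measure_Icc_lt_top).ne
      _ ≤ (volume : Measure ℝ).real (Icc a (-φ.rIn)) + (volume : Measure ℝ).real (Icc φ.rIn b) :=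
          measureReal_union_le _ _
      _ = Real.log 2 - 2 * φ.rIn := by
          rw [Real.volume_real_Icc_of_le (by rw [ha]; linarith),
            Real.volume_real_Icc_of_le (by rw [hb]; linarith), ha, hb]
          ring
  calc ‖testVector (isWeilTest_cutoffFun φ) a b - xi0‖ ^ 2
      = ∫ x, ‖((testVector (isWeilTest_cutoffFun φ) a b - xi0 : Lp ℂ 2 μ) : ℝ → ℂ) x‖ ^ 2 ∂μ :=
        norm_sq_eq_integral _
    _ ≤ μ.real (Icc (-φ.rIn) φ.rIn)ᶜ * M ^ 2 := by rw [← hg_int]; exact hint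
    _ ≤ (Real.log 2 - 2 * φ.rIn) * M ^ 2 := by gcongr
    _ = M ^ 2 * (Real.log 2 - 2 * φ.rIn) := by ring

/-- RH-FREE. **Test vectors approximate the witness**: for every `ε > 0` some cutoff `k_φ` supported in
`I` has `‖k_φ|_I − ξ₀‖ < ε`. [cite: ConnesConsani2021, Remark 6.12 §6.7 p. 29 ("since `C_c^∞` … is dense")] -/
theorem exists_cutoff_close {ε : ℝ} (hε : 0 < ε) :
    ∃ φ : ContDiffBump (0 : ℝ), φ.rOut < Real.log 2 / 2 ∧
      ‖testVector (isWeilTest_cutoffFun φ) (-(Real.log 2 / 2)) (Real.log 2 / 2) - xi0‖ < ε := by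
  set M : ℝ := ∑ m ∈ S, ‖((w m : ℚ) : ℂ)‖ * (Real.sqrt (Real.log 2 / 2 - -(Real.log 2 / 2)))⁻¹ with hM
  have hL : 0 < Real.log 2 := Real.log_pos one_lt_two
  -- width of the end strips
  set η : ℝ := min (Real.log 2 / 8) (ε ^ 2 / (4 * (M ^ 2 + 1))) with hη
  have hη0 : 0 < η := lt_min (by positivity) (by positivity)
  have hη1 : η ≤ Real.log 2 / 8 := min_le_left _ _
  have hη2 : η ≤ ε ^ 2 / (4 * (M ^ 2 + 1)) := min_le_right _ _
  let φ : ContDiffBump (0 : ℝ) :=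
    { rIn := Real.log 2 / 2 - 2 * η
      rOut := Real.log 2 / 2 - η
      rIn_pos := by linarith
      rIn_lt_rOut := by linarith }
  have hout : φ.rOut < Real.log 2 / 2 := by show Real.log 2 / 2 - η < Real.log 2 / 2; linarith
  refine ⟨φ, hout, ?_⟩
  have h1 := norm_testVector_cutoff_sub_xi0_sq_le φ hout
  have h2 : Real.log 2 - 2 * φ.rIn = 4 * η := by show Real.log 2 - 2 * (Real.log 2 / 2 - 2 * η) = 4 * η; ring
  rw [h2, ← hM] at h1
  have h3 : M ^ 2 * (4 * η) < ε ^ 2 := by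
    have h4 : M ^ 2 * (4 * η) ≤ M ^ 2 * (4 * (ε ^ 2 / (4 * (M ^ 2 + 1)))) := by gcongr
    have h5 : M ^ 2 * (4 * (ε ^ 2 / (4 * (M ^ 2 + 1)))) = ε ^ 2 * (M ^ 2 / (M ^ 2 + 1)) := by
      field_simp
    have h6 : M ^ 2 / (M ^ 2 + 1) < 1 := by
      rw [div_lt_one (by positivity)]; linarith
    calc M ^ 2 * (4 * η) ≤ M ^ 2 * (4 * (ε ^ 2 / (4 * (M ^ 2 + 1)))) := h4
      _ = ε ^ 2 * (M ^ 2 / (M ^ 2 + 1)) := h5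
      _ < ε ^ 2 := mul_lt_of_lt_one_right (by positivity) h6
  have h7 : ‖testVector (isWeilTest_cutoffFun φ) (-(Real.log 2 / 2)) (Real.log 2 / 2) - xi0‖ ^ 2
      < ε ^ 2 := h1.trans_lt h3
  exact lt_of_pow_lt_pow_left₀ 2 hε.le h7

end Rem612Cert

/-! ## Step 7: assembly — `CC2021_section6_enclosures → CC2021_rem_6_12` -/

/-- RH-FREE. **Remark 6.12 from the analytic input (E-a) of the §6 certificate**: for a `C²`
archimedean density `G` with `SpectralCert.AnalyticInputValid G` (`∫|τ_c − ϖ_G| ≤ 1/400`), the fact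
`CC2021_rem_6_12` holds — the continuous finite-rank form
`Ψ(ξ) = Σ c_n|⟨ξ_{n/2}|ξ⟩|² − (1+ε₁)‖ξ‖² − θ₁|⟨η₀|ξ⟩|²` is positive at the witness `ξ₀` (kernel-decided
certificate), hence at a nearby test vector `k_φ|_I`, which by (E-a) and Prop. 5.5 is a window witness.
[cite: ConnesConsani2021, Remark 6.12 §6.7 p. 29 (arXiv Remark 45, chunk p0029:L21–L40)] -/
theorem CC2021_rem_6_12_of_analyticInput {G : ℝ → ℂ} (hG : ContDiff ℝ 2 G) (hGa : IsArchDensity G)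
    (hEa : AnalyticInputValid G) : CC2021_rem_6_12 := by
  -- the continuous form `Ψ`
  set Ψ : Lp ℂ 2 (volume.restrict (Icc (-(Real.log 2 / 2)) (Real.log 2 / 2))) → ℝ := fun ξ ↦
    ∑ n ∈ Finset.Icc (-(CertAF.N : ℤ)) CertAF.N,
        (CertAF.c n.natAbs : ℝ) * ‖⟪expVector (-(Real.log 2 / 2)) (Real.log 2 / 2) ((n : ℝ) / 2), ξ⟫_ℂ‖ ^ 2
      - (1 + ((CertAF.ε₁ : ℚ) : ℝ)) * ‖ξ‖ ^ 2
      - ((Rem612Cert.θ₁ : ℚ) : ℝ) * ‖⟪constVector (-(Real.log 2 / 2)) (Real.log 2 / 2), ξ⟫_ℂ‖ ^ 2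
    with hΨ
  have hΨc : Continuous Ψ := by
    refine Continuous.sub (Continuous.sub (continuous_finsetSum _ fun n _ ↦ ?_) ?_) ?_
    · exact continuous_const.mul ((continuous_const.inner continuous_id).norm.pow 2)
    · exact continuous_const.mul (continuous_norm.pow 2)
    · exact continuous_const.mul ((continuous_const.inner continuous_id).norm.pow 2)
  have hΨ0 : 0 < Ψ Rem612Cert.xi0 := Rem612Cert.cert_xi0
  obtain ⟨ε, hε, hball⟩ := Metric.eventually_nhds_iff.1 (hΨc.continuousAt.eventually (lt_mem_nhds hΨ0))
  obtain ⟨φ, hφ, hclose⟩ := Rem612Cert.exists_cutoff_close hε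
  have hk : IsWeilTest (Rem612Cert.cutoffFun φ) := Rem612Cert.isWeilTest_cutoffFun φ
  have hks := Rem612Cert.tsupport_cutoffFun_subset φ hφ
  refine CC2021_rem_6_12_of_windowWitness hk hks hG hGa ?_
  have h1 := re_inner_windowOp_ge_of_analyticInput hG hEa
    (testVector hk (-(Real.log 2 / 2)) (Real.log 2 / 2))
  have h2 : 0 < Ψ (testVector hk (-(Real.log 2 / 2)) (Real.log 2 / 2)) :=
    hball (by rwa [dist_eq_norm])
  simp only [hΨ] at h2
  linarith

/-- RH-FREE. **`CC2021_section6_enclosures → CC2021_rem_6_12`**: the named numerical fact "the best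
constant `c` of (maininequ) exceeds `13`" (Remark 6.12) follows from the cell's single §6 numerical fact
(indeed from its first conjunct (E-a) alone; archimedean densities exist by
`exists_contDiff_isArchDensity_summable_free`).  With the Tier-2 kernel certificate of (E-a)
(`ArchKernelL1Frame.section6_enclosures_iff_L1`) this becomes the theorem `CC2021_rem_6_12_holds`.
[cite: ConnesConsani2021, Remark 6.12 §6.7 p. 29 (arXiv Remark 45, chunk p0029:L21–L40); §6.4 Fact 6.1 + Lemma 6.3 p. 24] -/
theorem CC2021_rem_6_12_of_section6Enclosures (h : CC2021_section6_enclosures) : CC2021_rem_6_12 := by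
  obtain ⟨G, hG, hGa, -⟩ := exists_contDiff_isArchDensity_summable_free
  exact CC2021_rem_6_12_of_analyticInput hG hGa (h.1 G hG hGa)

/-- RH-FREE. The same over K3's ONE real inequality `∫_{[−log 2, log 2]}|τ_c − ϖ| ≤ 1/400` for THE prolate
kernel `ϖ = prolateVarpi` (`ArchKernelL1Frame.section6_enclosures_iff_L1`).
[cite: ConnesConsani2021, Remark 6.12 §6.7 p. 29; §6.4 Fact 6.1 + Lemma 6.3 p. 24] -/
theorem CC2021_rem_6_12_of_L1_prolateVarpi
    (h : ∫ v in Icc (-Real.log 2) (Real.log 2),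
          ‖frameKernel (-(Real.log 2 / 2)) (Real.log 2 / 2) CertAF.N (fun n ↦ (CertAF.c n : ℝ)) v
              - ((prolateVarpi v : ℝ) : ℂ)‖
        ≤ ((CertAF.ε₁ : ℚ) : ℝ)) :
    CC2021_rem_6_12 :=
  CC2021_rem_6_12_of_section6Enclosures (section6_enclosures_iff_L1.2 h)

end Literature.NumberTheory.ConnesConsani2021

end
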